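import Literature.NumberTheory.Automorphic.HyperspecialUnitaryCartanIwasawaUniqueness
import Literature.NumberTheory.Automorphic.GLnSphericalHeckeAlgebraIntegralGenerators
import HarnessLib

/-!
# Products of Cartan double cosets of the unramified unitary group `U(σ, J₀)` are unitriangular over EVERY commutative
# ring: `c_a c_b = c_{a+b} + ∑_{ν < a+b} l_ν c_ν` (Cartier 1979 Thm. 4.1, proof (c); Macdonald Ch. V (2.6) for `GL_n`)

[topic NumberTheory/Automorphic] — lane `lit-hodgefound`, seat p11, generation 43, self-proposed theorem-only row g43-#4
(the `U(σ, J₀)` analogue of `GLnSphericalHeckeAlgebraTriangularProducts` (g42-#2) on top of the multiplicity-one theorem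
`HyperspecialUnitaryCartanIwasawaUniqueness` (g43-#3)).

## The print

Let `E/K` be an unramified quadratic extension of non-archimedean local fields with Galois involution `σ`, `J₀` the
antidiagonal hermitian form on `E^N`, `G = U(σ, J₀)` (quasi-split, unramified), `K₀ = G ∩ GL_N(𝒪_E)` its hyperspecial
maximal compact subgroup, `ℋ_R = ℋ(G, K₀; R)` the Hecke algebra with coefficients in a commutative ring `R`.  The Cartan
decomposition `G = ⨆_a K₀ diag(ϖ^a) K₀`, `a` running over the dominant antisymmetric exponents (`a_1 ≥ ⋯ ≥ a_N`,
`a_{N+1-i} = -a_i`, i.e. the dominant cocharacters of the maximal `K`-split torus) [Bruhat–Tits 1972, (4.4.3); tree: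
`heckeCosetMk_zpowDiagGL_eq_of_unitary`, `exists_basis_heckeAlgebra_unitary_antitone`] makes the characteristic functions
`c_a = T_{K₀ diag(ϖ^a) K₀}` an `R`-basis of `ℋ_R`.  Cartier [1979, §IV, proof of Thm. 4.1, step (c)] (for any unramified
`G`) and Macdonald [1995, Ch. V (2.6)] (for `GL_n`) prove that the Satake transform is unitriangular with respect to the
dominance order: `S c_λ = ∑_{μ ≤ λ} c(λ, μ) m_μ` with `c(λ, λ)` a unit, whence («by the same argument as in Chapter II, §2»)
`c_λ c_μ = c_{λ+μ} + ∑_{ν < λ+μ} g^ν_{λμ} c_ν`.  The two inputs of step (c) are Bruhat–Tits (4.4.4): (i) `K₀ t K₀ ∩ U t' K₀ ≠ ∅`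
forces `t' ≤ t` in the dominance order, (ii) `K₀ t K₀ ∩ U t K₀ = t K₀` — formalised for `U(σ, J₀)` from the antidominant end
in g43-#3 (`sum_ite_lt_le_sum_iwasawaExp_of_mem_orbit`, `card_filter_iwasawaExp_orbit_eq_one_unitary`).

## What is formalised (kernel path: theorems only, no new definitions, no named facts)

Throughout `hd : UnramifiedLocalConjDatum σ ϖ` (the unramified datum of `HyperspecialUnitaryCartan`), `R` any commutative
ring, `𝒮_w = (hd.isIwasawaExponent).satakeTransform w : ℋ_R →ₐ R[ℤ^N]` the abstract Satake transform of weight `w` of the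
Iwasawa exponents of `U(σ, J₀)` (`HyperspecialUnitarySatakeIwasawaDatum`), `𝒮_1` the counting transform, and for a dominant
antisymmetric `a` (`Antitone a ∧ ∀ i, a (rev i) = -a i`) `c_a = doubleCosetOperator K₀ ⟨diag(ϖ^a), _⟩`.
* §1 bookkeeping of dominant antisymmetric exponents (`antitone_add_of_antitone`, `antitone_list_sum`, `monotone_neg_of_antitone`).
* §2 `diag(ϖ^a)⁻¹ = diag(ϖ^{-a})` lies in `K₀ diag(ϖ^a) K₀` (conjugation by the longest Weyl element `P_rev ∈ K₀`):
  `inv_zpowDiagGL_mem_orbit_unitary`, `doubleCosetOperator_inv_zpowDiagGL_unitary` (`T_{K₀ t⁻¹ K₀} = T_{K₀ t K₀}`).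
* §3 BOTTOM TERMS, any weight `w`, any `R`: every exponent `μ` of `𝒮_w(c_a)` is dominance-above `-a`
  (`forall_sum_ite_lt_neg_le_of_coeff_satakeTransform_ne_zero`, (4.4.4) (i)); the coefficient of `x^{-a}` is `w(-a)`
  (`coeff_satakeTransform_doubleCosetOperator_neg`, (4.4.4) (ii)), `= 1` for `w = 1`; every exponent of every `𝒮_w(T)` is
  antisymmetric (`rev_of_coeff_satakeTransform_ne_zero`).
* §4 `T ∈ span_R {c_a}` (`mem_span_doubleCosetOperator_antitone_unitary`) and THE ENGINE
  `exists_finsupp_eq_sum_of_coeff_satakeTransform_one_unitary`: if `𝒮_1(T)` is above `-a₀` with coefficient `1` at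
  `x^{-a₀}` then `T = ∑_{a ≤ a₀} l_a c_a` with `l_{a₀} = 1` — by the abstract support lemmas of
  `GLnSphericalHeckeAlgebraIntegralGenerators` §1 applied to the family `a ↦ 𝒮_1(c_a)` and the injectivity of `𝒮_1`
  built into them (unit bottom coefficients).
* §5 PRODUCTS: bottom data multiply (`satakeTransform_one_mul_data_unitary`, from the pure `R[ℤ^N]` lemmas of
  `GLnSphericalHeckeAlgebraLeadingTerms` §1), hence `c_a c_b = ∑_{ν ≤ a+b} l_ν c_ν`, `l_{a+b} = 1`
  (`exists_finsupp_doubleCosetOperator_mul_eq_sum_unitary`), the split form `c_a c_b = c_{a+b} + ∑_{ν ≠ a+b} l_ν c_ν`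
  (`doubleCosetOperator_mul_eq_add_sum_unitary`), and the list version `c_{a_1} ⋯ c_{a_m} = c_{Σ a_k} + lower`
  (`exists_finsupp_list_prod_doubleCosetOperator_eq_sum_unitary`).
Commutativity of `ℋ_R` is already in the tree (`isGelfandPair_unitaryInt`, Gelfand's trick) and is not used or restated here.
"Lower" is recorded, as in the `GL_n` files, by head-sum inequalities of the antidominant representatives:
`∑_{i<t} (-(a+b))_i ≤ ∑_{i<t} (-ν)_i` for all `t` (equality of all head sums iff `ν = a + b`).

## References
* [cite: CartierCorvallis1979, §IV, Thm. 4.1 and its proof, step (c), pp. 147–148] — P. Cartier, Representations of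
  p-adic groups: a survey, Proc. Sympos. Pure Math. 33 (1979), part 1, 111–155.
* [cite: Macdonald1995, Ch. V (2.6), (2.7); Ch. II (2.3)] — I. G. Macdonald, Symmetric functions and Hall polynomials,
  2nd ed., Oxford 1995.
* [cite: BruhatTits1972, (4.4.3), (4.4.4)] — F. Bruhat, J. Tits, Groupes réductifs sur un corps local I, Publ. Math.
  IHÉS 41 (1972), 5–251.
* [cite: Tits1979, §3.3.3] — J. Tits, Reductive groups over local fields, Proc. Sympos. Pure Math. 33 (1979), part 1, 29–69.
* [cite: ShimuraIATAF1971, Prop. 3.1] — G. Shimura, Introduction to the arithmetic theory of automorphic functions, 1971.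
-/

noncomputable section

open scoped Valued WithZero Matrix MatrixGroups
open MonoidAlgebra Representation Finset MulAction

namespace Literature.NumberTheory.Automorphic.HermitianLattice

open Literature.NumberTheory.Automorphic.CartanUnique Literature.NumberTheory.Automorphic.SymplecticCartan

variable {K : Type*} [Field K] [Valued K ℤᵐ⁰] {σ : K →+* K} {ϖ : K} {N : ℕ}

/-! ## §1 Dominant (antitone) exponents: sums, negatives -/

omit [Valued K ℤᵐ⁰] in
/-- The sum of two dominant antisymmetric exponents is dominant antisymmetric. [cite: BruhatTits1972, (4.4.3)] -/
theorem antitone_add_of_antitone {a b : Fin N → ℤ} (ha : Antitone a ∧ ∀ i, a (Fin.rev i) = -a i)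
    (hb : Antitone b ∧ ∀ i, b (Fin.rev i) = -b i) : Antitone (a + b) ∧ ∀ i, (a + b) (Fin.rev i) = -(a + b) i :=
  ⟨fun _ _ hij => add_le_add (ha.1 hij) (hb.1 hij), fun i => by simp only [Pi.add_apply, ha.2, hb.2, neg_add]⟩

omit [Valued K ℤᵐ⁰] in
/-- The sum of a list of dominant antisymmetric exponents is dominant antisymmetric. [cite: BruhatTits1972, (4.4.3)] -/
theorem antitone_list_sum (L : List {a : Fin N → ℤ // Antitone a ∧ ∀ i, a (Fin.rev i) = -a i}) :
    Antitone (L.map Subtype.val).sum ∧ ∀ i, (L.map Subtype.val).sum (Fin.rev i) = -(L.map Subtype.val).sum i := by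
  induction L with
  | nil =>
    simp only [List.map_nil, List.sum_nil, Pi.zero_apply, neg_zero, implies_true, and_true]
    exact fun _ _ _ => le_rfl
  | cons a L ih =>
    rw [List.map_cons, List.sum_cons]
    exact antitone_add_of_antitone a.2 ih

omit [Valued K ℤᵐ⁰] in
/-- The negative of a dominant antisymmetric exponent is antidominant (monotone) antisymmetric. [cite: BruhatTits1972, (4.4.3)] -/
theorem monotone_neg_of_antitone {a : Fin N → ℤ} (ha : Antitone a ∧ ∀ i, a (Fin.rev i) = -a i) :
    Monotone (fun i => -a i) ∧ ∀ i, (fun j => -a j) (Fin.rev i) = -(fun j => -a j) i :=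
  ⟨fun _ _ hij => neg_le_neg (ha.1 hij), fun i => by simp only [ha.2 i, neg_neg]⟩

omit [Valued K ℤᵐ⁰] in
/-- Head sums of `-(a + b)` are those of `-a` plus those of `-b`. [cite: Macdonald1995, Ch. V (2.6)] -/
theorem neg_add_eq_neg_add_neg (a b : Fin N → ℤ) : (fun i => -(a + b) i) = (fun i => -a i) + fun i => -b i := by
  funext i
  simp only [Pi.add_apply, neg_add]

namespace UnramifiedLocalConjDatum

/-! ## §2 The inverse torus element inside its double coset -/

/-- `(diag(ϖ^a))⁻¹ = diag(ϖ^{-a})` as matrices. [cite: BruhatTits1972, (4.4.3)] -/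
theorem coe_inv_zpowDiagGL_unitary (hd : UnramifiedLocalConjDatum σ ϖ) {a : Fin N → ℤ} (ha : ∀ i, a (Fin.rev i) = -a i) :
    (((⟨zpowDiagGL (uniformizer_ne_zero hd.vϖ) a, zpowDiagGL_mem_unitaryGroupOfForm hd.σϖ _ ha⟩ :
        unitaryGroupOfForm σ ((StdForm.antidiagonal N).over K))⁻¹ : unitaryGroupOfForm σ ((StdForm.antidiagonal N).over K)) :
        GL (Fin N) K) = zpowDiagGL (uniformizer_ne_zero hd.vϖ) (fun i => -a i) := by
  rw [Subgroup.coe_inv, ← zpowDiagGL_neg]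
  rfl

/-- **`diag(ϖ^a)⁻¹ K₀ ⊆ K₀ diag(ϖ^a) K₀`**: the inverse torus element is conjugate to `diag(ϖ^a)` by the longest Weyl element
`P_rev ∈ K₀`. [cite: BruhatTits1972, (4.4.3)] [cite: Tits1979, §3.3.3] -/
theorem inv_zpowDiagGL_mem_orbit_unitary (hd : UnramifiedLocalConjDatum σ ϖ) {a : Fin N → ℤ} (ha : ∀ i, a (Fin.rev i) = -a i) :
    (((⟨zpowDiagGL (uniformizer_ne_zero hd.vϖ) a, zpowDiagGL_mem_unitaryGroupOfForm hd.σϖ _ ha⟩ :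
        unitaryGroupOfForm σ ((StdForm.antidiagonal N).over K))⁻¹ : unitaryGroupOfForm σ ((StdForm.antidiagonal N).over K)) :
        unitaryGroupOfForm σ ((StdForm.antidiagonal N).over K) ⧸ unitaryInt σ ((StdForm.antidiagonal N).over K)) ∈
      MulAction.orbit (unitaryInt σ ((StdForm.antidiagonal N).over K))
        ((⟨zpowDiagGL (uniformizer_ne_zero hd.vϖ) a, zpowDiagGL_mem_unitaryGroupOfForm hd.σϖ _ ha⟩ :
            unitaryGroupOfForm σ ((StdForm.antidiagonal N).over K)) :
          unitaryGroupOfForm σ ((StdForm.antidiagonal N).over K) ⧸ unitaryInt σ ((StdForm.antidiagonal N).over K)) := by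
  have hϖ0 := uniformizer_ne_zero hd.vϖ
  have hrev : ∀ i : Fin N, (Fin.revPerm : Equiv.Perm (Fin N)) (Fin.rev i) = Fin.rev (Fin.revPerm i) := fun i => rfl
  have hP := permGL_mem_unitaryInt (K := K) (σ := σ) (Fin.revPerm : Equiv.Perm (Fin N)) hrev
  have hTinv : (⟨zpowDiagGL hϖ0 a, zpowDiagGL_mem_unitaryGroupOfForm hd.σϖ hϖ0 ha⟩ :
        unitaryGroupOfForm σ ((StdForm.antidiagonal N).over K))⁻¹ =
      (⟨permGL Fin.revPerm, permGL_mem_unitaryGroupOfForm Fin.revPerm hrev⟩ :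
          unitaryGroupOfForm σ ((StdForm.antidiagonal N).over K)) *
        ⟨zpowDiagGL hϖ0 a, zpowDiagGL_mem_unitaryGroupOfForm hd.σϖ hϖ0 ha⟩ *
        (⟨permGL Fin.revPerm, permGL_mem_unitaryGroupOfForm Fin.revPerm hrev⟩ :
          unitaryGroupOfForm σ ((StdForm.antidiagonal N).over K))⁻¹ :=
    Subtype.ext (zpowDiagGL_inv_eq_conj_rev hϖ0 ha)
  exact (heckeAlgebra.coe_mem_orbit_coe_iff (unitaryInt σ ((StdForm.antidiagonal N).over K)) _ _).2
    ⟨_, hP, _, (unitaryInt σ _).inv_mem hP, hTinv⟩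

/-- The `K₀`-orbits of `diag(ϖ^a)⁻¹ K₀` and `diag(ϖ^a) K₀` coincide. [cite: BruhatTits1972, (4.4.3)] -/
theorem orbit_inv_zpowDiagGL_eq_unitary (hd : UnramifiedLocalConjDatum σ ϖ) {a : Fin N → ℤ} (ha : ∀ i, a (Fin.rev i) = -a i) :
    MulAction.orbit (unitaryInt σ ((StdForm.antidiagonal N).over K))
        (((⟨zpowDiagGL (uniformizer_ne_zero hd.vϖ) a, zpowDiagGL_mem_unitaryGroupOfForm hd.σϖ _ ha⟩ :
            unitaryGroupOfForm σ ((StdForm.antidiagonal N).over K))⁻¹ : unitaryGroupOfForm σ ((StdForm.antidiagonal N).over K)) :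
          unitaryGroupOfForm σ ((StdForm.antidiagonal N).over K) ⧸ unitaryInt σ ((StdForm.antidiagonal N).over K)) =
      MulAction.orbit (unitaryInt σ ((StdForm.antidiagonal N).over K))
        ((⟨zpowDiagGL (uniformizer_ne_zero hd.vϖ) a, zpowDiagGL_mem_unitaryGroupOfForm hd.σϖ _ ha⟩ :
            unitaryGroupOfForm σ ((StdForm.antidiagonal N).over K)) :
          unitaryGroupOfForm σ ((StdForm.antidiagonal N).over K) ⧸ unitaryInt σ ((StdForm.antidiagonal N).over K)) :=
  MulAction.orbit_eq_iff.2 (hd.inv_zpowDiagGL_mem_orbit_unitary ha)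

variable {R : Type*} [CommRing R]
  [IsHeckeTriple (⊤ : Submonoid (unitaryGroupOfForm σ ((StdForm.antidiagonal N).over K)))
    (unitaryInt σ ((StdForm.antidiagonal N).over K)) (unitaryInt σ ((StdForm.antidiagonal N).over K))]

/-- **`T_{K₀ diag(ϖ^a)⁻¹ K₀} = T_{K₀ diag(ϖ^a) K₀}`** (the same double coset). [cite: BruhatTits1972, (4.4.3)] -/
theorem doubleCosetOperator_inv_zpowDiagGL_unitary (hd : UnramifiedLocalConjDatum σ ϖ) {a : Fin N → ℤ}
    (ha : ∀ i, a (Fin.rev i) = -a i) :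
    heckeAlgebra.doubleCosetOperator (k := R) (unitaryInt σ ((StdForm.antidiagonal N).over K))
        ((⟨zpowDiagGL (uniformizer_ne_zero hd.vϖ) a, zpowDiagGL_mem_unitaryGroupOfForm hd.σϖ _ ha⟩ :
            unitaryGroupOfForm σ ((StdForm.antidiagonal N).over K))⁻¹) =
      heckeAlgebra.doubleCosetOperator (k := R) (unitaryInt σ ((StdForm.antidiagonal N).over K))
        (⟨zpowDiagGL (uniformizer_ne_zero hd.vϖ) a, zpowDiagGL_mem_unitaryGroupOfForm hd.σϖ _ ha⟩ :
            unitaryGroupOfForm σ ((StdForm.antidiagonal N).over K)) :=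
  heckeAlgebra.doubleCosetOperator_eq_of_mem_orbit (unitaryInt σ ((StdForm.antidiagonal N).over K))
    (hd.inv_zpowDiagGL_mem_orbit_unitary ha)

/-! ## §3 Bottom terms of `𝒮_w(c_a)`: exponents above `-a`, coefficient `w(-a)` at `x^{-a}`, all exponents antisymmetric -/

/-- **`𝒮_w(c_a)` is co-triangular with bottom `-a`** (`a` dominant antisymmetric, `c_a = T_{K₀ diag(ϖ^a) K₀}`, any weight, any
commutative ring): every exponent `μ` with non-zero coefficient satisfies `∑_{i<s} (-a)_i ≤ ∑_{i<s} μ_i` — Bruhat–Tits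
(4.4.4) (i) from the antidominant end (g43-#3) through the coefficient formula. [cite: BruhatTits1972, (4.4.4) (i)]
[cite: CartierCorvallis1979, §IV, proof of Thm. 4.1 (c)] -/
theorem forall_sum_ite_lt_neg_le_of_coeff_satakeTransform_ne_zero (hd : UnramifiedLocalConjDatum σ ϖ)
    (w : Multiplicative (Fin N → ℤ) →* R) {a : Fin N → ℤ} (ha : Antitone a ∧ ∀ i, a (Fin.rev i) = -a i) {μ : Fin N → ℤ}
    (hμ : ((hd.isIwasawaExponent (N := N)).satakeTransform w
      (heckeAlgebra.doubleCosetOperator (unitaryInt σ ((StdForm.antidiagonal N).over K))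
        (⟨zpowDiagGL (uniformizer_ne_zero hd.vϖ) a, zpowDiagGL_mem_unitaryGroupOfForm hd.σϖ _ ha.2⟩ :
            unitaryGroupOfForm σ ((StdForm.antidiagonal N).over K)))).coeff μ ≠ 0) (s : ℕ) :
    (∑ i : Fin N, if (i : ℕ) < s then (fun j => -a j) i else 0) ≤ ∑ i : Fin N, if (i : ℕ) < s then μ i else 0 := by
  by_contra hlt
  refine hμ ((hd.isIwasawaExponent (N := N)).coeff_satakeTransform_doubleCosetOperator_eq_zero w fun γ hγ he => hlt ?_)
  rw [← he]
  have hγ' : (γ.out : unitaryGroupOfForm σ ((StdForm.antidiagonal N).over K) ⧸ unitaryInt σ ((StdForm.antidiagonal N).over K)) ∈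
      MulAction.orbit (unitaryInt σ ((StdForm.antidiagonal N).over K))
        (((⟨zpowDiagGL (uniformizer_ne_zero hd.vϖ) a, zpowDiagGL_mem_unitaryGroupOfForm hd.σϖ _ ha.2⟩ :
            unitaryGroupOfForm σ ((StdForm.antidiagonal N).over K))⁻¹ : unitaryGroupOfForm σ ((StdForm.antidiagonal N).over K)) :
          unitaryGroupOfForm σ ((StdForm.antidiagonal N).over K) ⧸ unitaryInt σ ((StdForm.antidiagonal N).over K)) := by
    rw [hd.orbit_inv_zpowDiagGL_eq_unitary ha.2, QuotientGroup.out_eq']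
    exact hγ
  exact hd.sum_ite_lt_le_sum_iwasawaExp_of_mem_orbit (monotone_neg_of_antitone ha) (hd.coe_inv_zpowDiagGL_unitary ha.2) hγ' s

/-- **The bottom coefficient of `𝒮_w(c_a)` is the unit `w(-a)`** (`a` dominant antisymmetric): exactly one coset of
`K₀ diag(ϖ^a) K₀` has the antidominant exponents `-a` (g43-#3, Bruhat–Tits (4.4.4) (ii)).
[cite: BruhatTits1972, (4.4.4) (ii)] [cite: CartierCorvallis1979, §IV, proof of Thm. 4.1 (c)] -/
theorem coeff_satakeTransform_doubleCosetOperator_neg (hd : UnramifiedLocalConjDatum σ ϖ)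
    (w : Multiplicative (Fin N → ℤ) →* R) {a : Fin N → ℤ} (ha : Antitone a ∧ ∀ i, a (Fin.rev i) = -a i) :
    ((hd.isIwasawaExponent (N := N)).satakeTransform w
      (heckeAlgebra.doubleCosetOperator (unitaryInt σ ((StdForm.antidiagonal N).over K))
        (⟨zpowDiagGL (uniformizer_ne_zero hd.vϖ) a, zpowDiagGL_mem_unitaryGroupOfForm hd.σϖ _ ha.2⟩ :
            unitaryGroupOfForm σ ((StdForm.antidiagonal N).over K)))).coeff (fun i => -a i) =
      w (Multiplicative.ofAdd (fun i => -a i)) := by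
  rw [← hd.doubleCosetOperator_inv_zpowDiagGL_unitary (R := R) ha.2]
  exact hd.coeff_satakeTransform_doubleCosetOperator_zpowDiagGL_monotone_unitary w (monotone_neg_of_antitone ha)
    (hd.coe_inv_zpowDiagGL_unitary ha.2)

/-- The counting transform (`w = 1`): the bottom coefficient of `𝒮_1(c_a)` is `1`. [cite: BruhatTits1972, (4.4.4) (ii)] -/
theorem coeff_satakeTransform_one_doubleCosetOperator_neg (hd : UnramifiedLocalConjDatum σ ϖ) {a : Fin N → ℤ}
    (ha : Antitone a ∧ ∀ i, a (Fin.rev i) = -a i) :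
    ((hd.isIwasawaExponent (N := N)).satakeTransform (1 : Multiplicative (Fin N → ℤ) →* R)
      (heckeAlgebra.doubleCosetOperator (unitaryInt σ ((StdForm.antidiagonal N).over K))
        (⟨zpowDiagGL (uniformizer_ne_zero hd.vϖ) a, zpowDiagGL_mem_unitaryGroupOfForm hd.σϖ _ ha.2⟩ :
            unitaryGroupOfForm σ ((StdForm.antidiagonal N).over K)))).coeff (fun i => -a i) = 1 := by
  rw [hd.coeff_satakeTransform_doubleCosetOperator_neg 1 ha, MonoidHom.one_apply]

/-- **Every exponent of `𝒮_w(T)`, `T ∈ ℋ(U(σ, J₀), K₀; R)`, is antisymmetric** (`μ ∘ rev = -μ`): the Iwasawa exponents of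
`U(σ, J₀)` are cocharacters of the maximal split torus. [cite: BruhatTits1972, (4.4.3)] [cite: CartierCorvallis1979, §IV (4.2)] -/
theorem rev_of_coeff_satakeTransform_ne_zero (hd : UnramifiedLocalConjDatum σ ϖ) (w : Multiplicative (Fin N → ℤ) →* R)
    (T : heckeAlgebra R (unitaryGroupOfForm σ ((StdForm.antidiagonal N).over K)) (unitaryInt σ ((StdForm.antidiagonal N).over K)))
    {μ : Fin N → ℤ} (hμ : ((hd.isIwasawaExponent (N := N)).satakeTransform w T).coeff μ ≠ 0) (i : Fin N) :
    μ (Fin.rev i) = -μ i := by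
  classical
  revert hμ
  refine Submodule.span_induction (p := fun T _ => ((hd.isIwasawaExponent (N := N)).satakeTransform w T).coeff μ ≠ 0 →
      μ (Fin.rev i) = -μ i) ?_ ?_ ?_ ?_
    (heckeAlgebra.mem_span_range_doubleCosetOperator (k := R) (unitaryInt σ ((StdForm.antidiagonal N).over K)) T)
  · rintro _ ⟨g, rfl⟩ hμ
    by_contra hne
    refine hμ ((hd.isIwasawaExponent (N := N)).coeff_satakeTransform_doubleCosetOperator_eq_zero w fun γ _ he => hne ?_)
    rw [← he]
    exact hd.iwasawaExp_rev _ i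
  · intro h
    exact absurd (by rw [map_zero, AddMonoidAlgebra.coeff_zero, Finsupp.zero_apply]) h
  · intro x y _ _ hx hy hxy
    rw [map_add, AddMonoidAlgebra.coeff_add, Finsupp.add_apply] at hxy
    by_cases h : ((hd.isIwasawaExponent (N := N)).satakeTransform w x).coeff μ = 0
    · rw [h, zero_add] at hxy
      exact hy hxy
    · exact hx h
  · intro c x _ hx hcx
    rw [map_smul, AddMonoidAlgebra.coeff_smul, Finsupp.smul_apply, smul_eq_mul] at hcx
    exact hx (right_ne_zero_of_mul hcx)

/-! ## §4 Every `T` is a combination of Cartan operators `c_a`, `a` dominant; the expansion from bottom data (THE ENGINE) -/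

/-- **Every `T ∈ ℋ(U(σ, J₀), K₀; R)` is an `R`-combination of the `c_a = T_{K₀ diag(ϖ^a) K₀}`, `a` dominant antisymmetric**
(double-coset spanning + the Cartan decomposition `heckeCosetMk_zpowDiagGL_eq_of_unitary`). [cite: BruhatTits1972, (4.4.3)]
[cite: ShimuraIATAF1971, Prop. 3.1] -/
theorem mem_span_doubleCosetOperator_antitone_unitary (hd : UnramifiedLocalConjDatum σ ϖ)
    (T : heckeAlgebra R (unitaryGroupOfForm σ ((StdForm.antidiagonal N).over K)) (unitaryInt σ ((StdForm.antidiagonal N).over K))) :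
    T ∈ Submodule.span R (Set.range fun a : {a : Fin N → ℤ // Antitone a ∧ ∀ i, a (Fin.rev i) = -a i} =>
      heckeAlgebra.doubleCosetOperator (k := R) (unitaryInt σ ((StdForm.antidiagonal N).over K))
        (⟨zpowDiagGL (uniformizer_ne_zero hd.vϖ) a.1, zpowDiagGL_mem_unitaryGroupOfForm hd.σϖ _ a.2.2⟩ :
            unitaryGroupOfForm σ ((StdForm.antidiagonal N).over K))) := by
  refine (Submodule.span_le.2 ?_) (heckeAlgebra.mem_span_doubleCosetOperator (k := R)
    (unitaryInt σ ((StdForm.antidiagonal N).over K)) T)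
  rintro _ ⟨γ, -, rfl⟩
  obtain ⟨a, ha, hmk⟩ := heckeCosetMk_zpowDiagGL_eq_of_unitary hd γ.out
  obtain ⟨A, hA, B, hB, hAB⟩ := (heckeAlgebra.heckeCosetMk_eq_iff (unitaryInt σ ((StdForm.antidiagonal N).over K))
    (Submonoid.mem_top _) (Submonoid.mem_top _)).1 hmk
  have horb : (γ.out : unitaryGroupOfForm σ ((StdForm.antidiagonal N).over K) ⧸ unitaryInt σ ((StdForm.antidiagonal N).over K)) ∈
      MulAction.orbit (unitaryInt σ ((StdForm.antidiagonal N).over K))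
        ((⟨zpowDiagGL (uniformizer_ne_zero hd.vϖ) a, zpowDiagGL_mem_unitaryGroupOfForm hd.σϖ _ ha.2⟩ :
            unitaryGroupOfForm σ ((StdForm.antidiagonal N).over K)) :
          unitaryGroupOfForm σ ((StdForm.antidiagonal N).over K) ⧸ unitaryInt σ ((StdForm.antidiagonal N).over K)) :=
    (heckeAlgebra.coe_mem_orbit_coe_iff (unitaryInt σ ((StdForm.antidiagonal N).over K)) _ _).2 ⟨A, hA, B, hB, hAB⟩
  change heckeAlgebra.doubleCosetOperator (k := R) (unitaryInt σ ((StdForm.antidiagonal N).over K)) γ.out ∈ _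
  rw [heckeAlgebra.doubleCosetOperator_eq_of_mem_orbit (unitaryInt σ ((StdForm.antidiagonal N).over K)) horb]
  exact Submodule.subset_span ⟨⟨a, ha⟩, rfl⟩

/-- **THE ENGINE** (unitary version of `exists_finsupp_eq_sum_of_coeff_satakeTransform_one`).  Let `T ∈ ℋ_R` and `a₀`
dominant antisymmetric.  If every exponent of the counting transform `𝒮_1(T)` is dominance-above `-a₀` and the coefficient of
`x^{-a₀}` is `1`, then `T = ∑_a l_a c_a` over dominant antisymmetric `a` with `-a` above `-a₀` (i.e. `a ≤ a₀`) and `l_{a₀} = 1`.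
[cite: CartierCorvallis1979, §IV, proof of Thm. 4.1 (c)] [cite: Macdonald1995, Ch. V (2.6)] [cite: BruhatTits1972, (4.4.4) (ii)] -/
theorem exists_finsupp_eq_sum_of_coeff_satakeTransform_one_unitary (hd : UnramifiedLocalConjDatum σ ϖ)
    {T : heckeAlgebra R (unitaryGroupOfForm σ ((StdForm.antidiagonal N).over K)) (unitaryInt σ ((StdForm.antidiagonal N).over K))}
    {a₀ : Fin N → ℤ} (ha₀ : Antitone a₀ ∧ ∀ i, a₀ (Fin.rev i) = -a₀ i)
    (htri : ∀ μ, ((hd.isIwasawaExponent (N := N)).satakeTransform (1 : Multiplicative (Fin N → ℤ) →* R) T).coeff μ ≠ 0 →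
      ∀ t : ℕ, (∑ i : Fin N, if (i : ℕ) < t then (fun j => -a₀ j) i else 0) ≤ ∑ i : Fin N, if (i : ℕ) < t then μ i else 0)
    (hlead : ((hd.isIwasawaExponent (N := N)).satakeTransform (1 : Multiplicative (Fin N → ℤ) →* R) T).coeff (fun j => -a₀ j) = 1) :
    ∃ l : {a : Fin N → ℤ // Antitone a ∧ ∀ i, a (Fin.rev i) = -a i} →₀ R,
      (∀ a ∈ l.support, ∀ t : ℕ, (∑ i : Fin N, if (i : ℕ) < t then (fun j => -a₀ j) i else 0) ≤
        ∑ i : Fin N, if (i : ℕ) < t then (fun j => -(a : Fin N → ℤ) j) i else 0) ∧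
      l ⟨a₀, ha₀⟩ = 1 ∧
      T = ∑ a ∈ l.support, l a • heckeAlgebra.doubleCosetOperator (k := R) (unitaryInt σ ((StdForm.antidiagonal N).over K))
        (⟨zpowDiagGL (uniformizer_ne_zero hd.vϖ) a.1, zpowDiagGL_mem_unitaryGroupOfForm hd.σϖ _ a.2.2⟩ :
            unitaryGroupOfForm σ ((StdForm.antidiagonal N).over K)) := by
  classical
  set S := (hd.isIwasawaExponent (N := N)).satakeTransform (1 : Multiplicative (Fin N → ℤ) →* R) with hS
  set c : {a : Fin N → ℤ // Antitone a ∧ ∀ i, a (Fin.rev i) = -a i} →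
      heckeAlgebra R (unitaryGroupOfForm σ ((StdForm.antidiagonal N).over K)) (unitaryInt σ ((StdForm.antidiagonal N).over K)) :=
    fun a => heckeAlgebra.doubleCosetOperator (k := R) (unitaryInt σ ((StdForm.antidiagonal N).over K))
      (⟨zpowDiagGL (uniformizer_ne_zero hd.vϖ) a.1, zpowDiagGL_mem_unitaryGroupOfForm hd.σϖ _ a.2.2⟩ :
        unitaryGroupOfForm σ ((StdForm.antidiagonal N).over K)) with hc
  obtain ⟨l, hlT⟩ := (Finsupp.mem_span_range_iff_exists_finsupp).1 (hd.mem_span_doubleCosetOperator_antitone_unitary (R := R) T)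
  -- `T = Σ_a l_a c_a`
  have hlT' : T = ∑ a ∈ l.support, l a • c a := by rw [← hlT, Finsupp.sum]
  have hST : (∑ a ∈ l.support, l a • S (c a)) = S T := by
    have h1 : S.toLinearMap T = ∑ a ∈ l.support, S.toLinearMap (l a • c a) := by rw [hlT', map_sum]
    rw [AlgHom.toLinearMap_apply] at h1
    rw [h1]
    exact Finset.sum_congr rfl fun a _ => by rw [map_smul, AlgHom.toLinearMap_apply]
  -- hypotheses of the abstract support lemmas for the family `a ↦ 𝒮_1(c_a)` with bottoms `-a`
  have hsupp : ∀ a ∈ l.support, ∀ μ, (S (c a)).coeff μ ≠ 0 →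
      ∀ t : ℕ, (∑ i : Fin N, if (i : ℕ) < t then (fun j => -(a : Fin N → ℤ) j) i else 0) ≤
        ∑ i : Fin N, if (i : ℕ) < t then μ i else 0 :=
    fun a _ μ hμ t => hd.forall_sum_ite_lt_neg_le_of_coeff_satakeTransform_ne_zero 1 a.2 hμ t
  have hlead' : ∀ a ∈ l.support, IsUnit ((S (c a)).coeff (fun j => -(a : Fin N → ℤ) j)) := fun a _ => by
    rw [hd.coeff_satakeTransform_one_doubleCosetOperator_neg a.2]
    exact isUnit_one
  have hinj : Set.InjOn (fun a : {a : Fin N → ℤ // Antitone a ∧ ∀ i, a (Fin.rev i) = -a i} => fun j => -(a : Fin N → ℤ) j)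
      ↑l.support := fun a _ b _ h => Subtype.ext (funext fun j => neg_injective (congrFun h j))
  have hXtri : ∀ μ, (∑ a ∈ l.support, l a • S (c a)).coeff μ ≠ 0 →
      ∀ t : ℕ, (∑ i : Fin N, if (i : ℕ) < t then (fun j => -a₀ j) i else 0) ≤ ∑ i : Fin N, if (i : ℕ) < t then μ i else 0 := by
    rw [hST]
    exact htri
  -- every `a` of the support has `-a` above `-a₀`
  have habove : ∀ a ∈ l.support, ∀ t : ℕ, (∑ i : Fin N, if (i : ℕ) < t then (fun j => -a₀ j) i else 0) ≤
      ∑ i : Fin N, if (i : ℕ) < t then (fun j => -(a : Fin N → ℤ) j) i else 0 := fun a ha t =>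
    forall_sum_ite_lt_le_of_coeff_sum_smul_ne_zero l.support (fun a => l a) (fun a => S (c a))
      (fun a => fun j => -(a : Fin N → ℤ) j) hinj hsupp hlead' (fun j => -a₀ j) hXtri ha (Finsupp.mem_support_iff.1 ha) t
  -- the coefficient `l_{a₀}`: compare the coefficients of `x^{-a₀}` over the support enlarged by `a₀`
  have hsupp' : ∀ a ∈ insert (⟨a₀, ha₀⟩ : {a : Fin N → ℤ // Antitone a ∧ ∀ i, a (Fin.rev i) = -a i}) l.support, ∀ μ,
      (S (c a)).coeff μ ≠ 0 →
      ∀ t : ℕ, (∑ i : Fin N, if (i : ℕ) < t then (fun j => -(a : Fin N → ℤ) j) i else 0) ≤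
        ∑ i : Fin N, if (i : ℕ) < t then μ i else 0 :=
    fun a _ μ hμ t => hd.forall_sum_ite_lt_neg_le_of_coeff_satakeTransform_ne_zero 1 a.2 hμ t
  have hinj' : Set.InjOn (fun a : {a : Fin N → ℤ // Antitone a ∧ ∀ i, a (Fin.rev i) = -a i} => fun j => -(a : Fin N → ℤ) j)
      ↑(insert (⟨a₀, ha₀⟩ : {a : Fin N → ℤ // Antitone a ∧ ∀ i, a (Fin.rev i) = -a i}) l.support) :=
    fun a _ b _ h => Subtype.ext (funext fun j => neg_injective (congrFun h j))
  have hsum' : (∑ a ∈ insert (⟨a₀, ha₀⟩ : {a : Fin N → ℤ // Antitone a ∧ ∀ i, a (Fin.rev i) = -a i}) l.support,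
      l a • S (c a)) = ∑ a ∈ l.support, l a • S (c a) :=
    Finset.sum_insert_of_eq_zero_if_notMem fun h => by rw [Finsupp.notMem_support_iff.1 h, zero_smul]
  have hcoef := coeff_sum_smul_eq_mul_of_forall_le (insert (⟨a₀, ha₀⟩ : {a : Fin N → ℤ // Antitone a ∧ ∀ i, a (Fin.rev i) = -a i})
    l.support) (fun a => l a) (fun a => S (c a)) (fun a => fun j => -(a : Fin N → ℤ) j) hinj' hsupp' (Finset.mem_insert_self _ _)
    (fun a ha _ t => by
      rcases Finset.mem_insert.1 ha with rfl | ha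
      · exact le_rfl
      · exact habove a ha t)
  rw [hsum', hST] at hcoef
  change (S T).coeff (fun j => -a₀ j) = l ⟨a₀, ha₀⟩ * (S (c ⟨a₀, ha₀⟩)).coeff (fun j => -a₀ j) at hcoef
  rw [hlead, hd.coeff_satakeTransform_one_doubleCosetOperator_neg ha₀, mul_one] at hcoef
  exact ⟨l, habove, hcoef.symm, hlT'⟩

/-! ## §5 Products of Cartan double cosets are unitriangular -/

omit [IsHeckeTriple (⊤ : Submonoid (unitaryGroupOfForm σ ((StdForm.antidiagonal N).over K)))
    (unitaryInt σ ((StdForm.antidiagonal N).over K)) (unitaryInt σ ((StdForm.antidiagonal N).over K))] in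
/-- **Bottom data multiply**: if `𝒮_1(T₁)` is above `-a` with coefficient `1` at `x^{-a}` and `𝒮_1(T₂)` is above `-b` with
coefficient `1` at `x^{-b}`, then `𝒮_1(T₁ T₂)` is above `-(a+b)` with coefficient `1` at `x^{-(a+b)}`.
[cite: Macdonald1995, Ch. V (2.6)] [cite: CartierCorvallis1979, §IV, proof of Thm. 4.1 (c)] -/
theorem satakeTransform_one_mul_data_unitary (hd : UnramifiedLocalConjDatum σ ϖ)
    {T₁ T₂ : heckeAlgebra R (unitaryGroupOfForm σ ((StdForm.antidiagonal N).over K)) (unitaryInt σ ((StdForm.antidiagonal N).over K))}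
    {a b : Fin N → ℤ}
    (h₁ : (∀ μ, ((hd.isIwasawaExponent (N := N)).satakeTransform (1 : Multiplicative (Fin N → ℤ) →* R) T₁).coeff μ ≠ 0 →
        ∀ t : ℕ, (∑ i : Fin N, if (i : ℕ) < t then (fun j => -a j) i else 0) ≤ ∑ i : Fin N, if (i : ℕ) < t then μ i else 0) ∧
      ((hd.isIwasawaExponent (N := N)).satakeTransform (1 : Multiplicative (Fin N → ℤ) →* R) T₁).coeff (fun j => -a j) = 1)
    (h₂ : (∀ μ, ((hd.isIwasawaExponent (N := N)).satakeTransform (1 : Multiplicative (Fin N → ℤ) →* R) T₂).coeff μ ≠ 0 →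
        ∀ t : ℕ, (∑ i : Fin N, if (i : ℕ) < t then (fun j => -b j) i else 0) ≤ ∑ i : Fin N, if (i : ℕ) < t then μ i else 0) ∧
      ((hd.isIwasawaExponent (N := N)).satakeTransform (1 : Multiplicative (Fin N → ℤ) →* R) T₂).coeff (fun j => -b j) = 1) :
    (∀ μ, ((hd.isIwasawaExponent (N := N)).satakeTransform (1 : Multiplicative (Fin N → ℤ) →* R) (T₁ * T₂)).coeff μ ≠ 0 →
        ∀ t : ℕ, (∑ i : Fin N, if (i : ℕ) < t then (fun j => -(a + b) j) i else 0) ≤ ∑ i : Fin N, if (i : ℕ) < t then μ i else 0) ∧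
      ((hd.isIwasawaExponent (N := N)).satakeTransform (1 : Multiplicative (Fin N → ℤ) →* R) (T₁ * T₂)).coeff
        (fun j => -(a + b) j) = 1 := by
  obtain ⟨h₁t, h₁l⟩ := h₁
  obtain ⟨h₂t, h₂l⟩ := h₂
  rw [neg_add_eq_neg_add_neg]
  refine ⟨fun μ hμ t => ?_, ?_⟩
  · rw [map_mul] at hμ
    exact forall_sum_ite_lt_le_of_coeff_mul_ne_zero h₁t h₂t hμ t
  · rw [map_mul, coeff_mul_add_eq_mul_coeff_of_forall_sum_ite_lt_le h₁t h₂t, h₁l, h₂l, mul_one]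

/-- Bottom data of `c_a` (`a` dominant antisymmetric): exponents above `-a`, coefficient `1` at `x^{-a}`.
[cite: BruhatTits1972, (4.4.4) (i), (ii)] -/
theorem coeff_satakeTransform_one_data_unitary (hd : UnramifiedLocalConjDatum σ ϖ) {a : Fin N → ℤ}
    (ha : Antitone a ∧ ∀ i, a (Fin.rev i) = -a i) :
    (∀ μ, ((hd.isIwasawaExponent (N := N)).satakeTransform (1 : Multiplicative (Fin N → ℤ) →* R)
        (heckeAlgebra.doubleCosetOperator (unitaryInt σ ((StdForm.antidiagonal N).over K))
          (⟨zpowDiagGL (uniformizer_ne_zero hd.vϖ) a, zpowDiagGL_mem_unitaryGroupOfForm hd.σϖ _ ha.2⟩ :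
              unitaryGroupOfForm σ ((StdForm.antidiagonal N).over K)))).coeff μ ≠ 0 →
      ∀ t : ℕ, (∑ i : Fin N, if (i : ℕ) < t then (fun j => -a j) i else 0) ≤ ∑ i : Fin N, if (i : ℕ) < t then μ i else 0) ∧
    ((hd.isIwasawaExponent (N := N)).satakeTransform (1 : Multiplicative (Fin N → ℤ) →* R)
        (heckeAlgebra.doubleCosetOperator (unitaryInt σ ((StdForm.antidiagonal N).over K))
          (⟨zpowDiagGL (uniformizer_ne_zero hd.vϖ) a, zpowDiagGL_mem_unitaryGroupOfForm hd.σϖ _ ha.2⟩ :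
              unitaryGroupOfForm σ ((StdForm.antidiagonal N).over K)))).coeff (fun j => -a j) = 1 :=
  ⟨fun _ hμ t => hd.forall_sum_ite_lt_neg_le_of_coeff_satakeTransform_ne_zero 1 ha hμ t,
    hd.coeff_satakeTransform_one_doubleCosetOperator_neg ha⟩

/-- **PRODUCTS OF CARTAN DOUBLE COSETS OF `U(σ, J₀)` ARE UNITRIANGULAR, OVER ANY COMMUTATIVE RING `R`**: for dominant
antisymmetric `a, b`, `c_a c_b = ∑_ν l_ν c_ν` over dominant antisymmetric `ν ≤ a + b` (`-ν` dominance-above `-(a+b)`) with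
`l_{a+b} = 1` — Cartier's step (c) («`c(λ, λ') ≠ 0` only for `λ' ≤ λ`, `c(λ, λ) = δ(λ)^{1/2}`» transported to the structure
constants), Macdonald's `c_λ c_μ = c_{λ+μ} + ∑_{ν<λ+μ} g^ν_{λμ} c_ν` for `GL_n`; here for the unramified unitary group.
[cite: CartierCorvallis1979, §IV, proof of Thm. 4.1 (c)] [cite: Macdonald1995, Ch. V (2.6)] [cite: BruhatTits1972, (4.4.4) (ii)] -/
theorem exists_finsupp_doubleCosetOperator_mul_eq_sum_unitary (hd : UnramifiedLocalConjDatum σ ϖ) {a b : Fin N → ℤ}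
    (ha : Antitone a ∧ ∀ i, a (Fin.rev i) = -a i) (hb : Antitone b ∧ ∀ i, b (Fin.rev i) = -b i) :
    ∃ l : {a : Fin N → ℤ // Antitone a ∧ ∀ i, a (Fin.rev i) = -a i} →₀ R,
      (∀ ν ∈ l.support, ∀ t : ℕ, (∑ i : Fin N, if (i : ℕ) < t then (fun j => -(a + b) j) i else 0) ≤
        ∑ i : Fin N, if (i : ℕ) < t then (fun j => -(ν : Fin N → ℤ) j) i else 0) ∧
      l ⟨a + b, antitone_add_of_antitone ha hb⟩ = 1 ∧
      heckeAlgebra.doubleCosetOperator (k := R) (unitaryInt σ ((StdForm.antidiagonal N).over K))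
            (⟨zpowDiagGL (uniformizer_ne_zero hd.vϖ) a, zpowDiagGL_mem_unitaryGroupOfForm hd.σϖ _ ha.2⟩ :
                unitaryGroupOfForm σ ((StdForm.antidiagonal N).over K)) *
          heckeAlgebra.doubleCosetOperator (k := R) (unitaryInt σ ((StdForm.antidiagonal N).over K))
            (⟨zpowDiagGL (uniformizer_ne_zero hd.vϖ) b, zpowDiagGL_mem_unitaryGroupOfForm hd.σϖ _ hb.2⟩ :
                unitaryGroupOfForm σ ((StdForm.antidiagonal N).over K)) =
        ∑ ν ∈ l.support, l ν • heckeAlgebra.doubleCosetOperator (k := R) (unitaryInt σ ((StdForm.antidiagonal N).over K))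
          (⟨zpowDiagGL (uniformizer_ne_zero hd.vϖ) ν.1, zpowDiagGL_mem_unitaryGroupOfForm hd.σϖ _ ν.2.2⟩ :
              unitaryGroupOfForm σ ((StdForm.antidiagonal N).over K)) := by
  obtain ⟨htri, hlead⟩ := hd.satakeTransform_one_mul_data_unitary (hd.coeff_satakeTransform_one_data_unitary (R := R) ha)
    (hd.coeff_satakeTransform_one_data_unitary (R := R) hb)
  exact hd.exists_finsupp_eq_sum_of_coeff_satakeTransform_one_unitary (antitone_add_of_antitone ha hb) htri hlead

/-- **`c_a c_b = c_{a+b} + ∑_{ν ≠ a+b, ν ≤ a+b} l_ν c_ν`**: the leading term split off (any `R`).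
[cite: CartierCorvallis1979, §IV, proof of Thm. 4.1 (c)] [cite: Macdonald1995, Ch. V (2.6)] -/
theorem doubleCosetOperator_mul_eq_add_sum_unitary (hd : UnramifiedLocalConjDatum σ ϖ) {a b : Fin N → ℤ}
    (ha : Antitone a ∧ ∀ i, a (Fin.rev i) = -a i) (hb : Antitone b ∧ ∀ i, b (Fin.rev i) = -b i) :
    ∃ l : {a : Fin N → ℤ // Antitone a ∧ ∀ i, a (Fin.rev i) = -a i} →₀ R,
      (∀ ν ∈ l.support.erase ⟨a + b, antitone_add_of_antitone ha hb⟩, (ν : Fin N → ℤ) ≠ a + b ∧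
        ∀ t : ℕ, (∑ i : Fin N, if (i : ℕ) < t then (fun j => -(a + b) j) i else 0) ≤
          ∑ i : Fin N, if (i : ℕ) < t then (fun j => -(ν : Fin N → ℤ) j) i else 0) ∧
      heckeAlgebra.doubleCosetOperator (k := R) (unitaryInt σ ((StdForm.antidiagonal N).over K))
            (⟨zpowDiagGL (uniformizer_ne_zero hd.vϖ) a, zpowDiagGL_mem_unitaryGroupOfForm hd.σϖ _ ha.2⟩ :
                unitaryGroupOfForm σ ((StdForm.antidiagonal N).over K)) *
          heckeAlgebra.doubleCosetOperator (k := R) (unitaryInt σ ((StdForm.antidiagonal N).over K))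
            (⟨zpowDiagGL (uniformizer_ne_zero hd.vϖ) b, zpowDiagGL_mem_unitaryGroupOfForm hd.σϖ _ hb.2⟩ :
                unitaryGroupOfForm σ ((StdForm.antidiagonal N).over K)) =
        heckeAlgebra.doubleCosetOperator (k := R) (unitaryInt σ ((StdForm.antidiagonal N).over K))
            (⟨zpowDiagGL (uniformizer_ne_zero hd.vϖ) (a + b), zpowDiagGL_mem_unitaryGroupOfForm hd.σϖ _
                (antitone_add_of_antitone ha hb).2⟩ : unitaryGroupOfForm σ ((StdForm.antidiagonal N).over K)) +
          ∑ ν ∈ l.support.erase ⟨a + b, antitone_add_of_antitone ha hb⟩, l ν •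
            heckeAlgebra.doubleCosetOperator (k := R) (unitaryInt σ ((StdForm.antidiagonal N).over K))
              (⟨zpowDiagGL (uniformizer_ne_zero hd.vϖ) ν.1, zpowDiagGL_mem_unitaryGroupOfForm hd.σϖ _ ν.2.2⟩ :
                  unitaryGroupOfForm σ ((StdForm.antidiagonal N).over K)) := by
  classical
  obtain ⟨l, hl, hla, hprod⟩ := hd.exists_finsupp_doubleCosetOperator_mul_eq_sum_unitary (R := R) ha hb
  refine ⟨l, fun ν hν => ?_, ?_⟩
  · obtain ⟨hne, hν⟩ := Finset.mem_erase.1 hν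
    exact ⟨fun h => hne (Subtype.ext h), hl ν hν⟩
  · rw [hprod]
    by_cases hmem : (⟨a + b, antitone_add_of_antitone ha hb⟩ : {a : Fin N → ℤ // Antitone a ∧ ∀ i, a (Fin.rev i) = -a i}) ∈
        l.support
    · rw [← Finset.add_sum_erase _ _ hmem, hla, one_smul]
    · have h0 : l ⟨a + b, antitone_add_of_antitone ha hb⟩ = 0 := Finsupp.notMem_support_iff.1 hmem
      rw [hla] at h0
      have hR : ∀ x : heckeAlgebra R (unitaryGroupOfForm σ ((StdForm.antidiagonal N).over K))
          (unitaryInt σ ((StdForm.antidiagonal N).over K)), x = 0 := fun x => by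
        rw [← one_smul R x, h0, zero_smul]
      rw [hR (∑ ν ∈ l.support, _), hR (_ + _)]

/-- **A PRODUCT `c_{a_1} ⋯ c_{a_m}` OF CARTAN DOUBLE COSETS IS `c_{a_1 + ⋯ + a_m} +` LOWER TERMS** (any `R`): for a list of
dominant antisymmetric exponents, `∏ c_{a_k} = ∑_ν l_ν c_ν` with `l_{Σ a_k} = 1` and every `ν` of the support `≤ Σ a_k`.
[cite: Macdonald1995, Ch. II (2.3), proof; Ch. V (2.6)] [cite: CartierCorvallis1979, §IV, proof of Thm. 4.1 (c)] -/
theorem exists_finsupp_list_prod_doubleCosetOperator_eq_sum_unitary (hd : UnramifiedLocalConjDatum σ ϖ)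
    (L : List {a : Fin N → ℤ // Antitone a ∧ ∀ i, a (Fin.rev i) = -a i}) :
    ∃ l : {a : Fin N → ℤ // Antitone a ∧ ∀ i, a (Fin.rev i) = -a i} →₀ R,
      (∀ ν ∈ l.support, ∀ t : ℕ, (∑ i : Fin N, if (i : ℕ) < t then (fun j => -(L.map Subtype.val).sum j) i else 0) ≤
        ∑ i : Fin N, if (i : ℕ) < t then (fun j => -(ν : Fin N → ℤ) j) i else 0) ∧
      l ⟨(L.map Subtype.val).sum, antitone_list_sum L⟩ = 1 ∧
      (L.map fun a => heckeAlgebra.doubleCosetOperator (k := R) (unitaryInt σ ((StdForm.antidiagonal N).over K))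
          (⟨zpowDiagGL (uniformizer_ne_zero hd.vϖ) a.1, zpowDiagGL_mem_unitaryGroupOfForm hd.σϖ _ a.2.2⟩ :
              unitaryGroupOfForm σ ((StdForm.antidiagonal N).over K))).prod =
        ∑ ν ∈ l.support, l ν • heckeAlgebra.doubleCosetOperator (k := R) (unitaryInt σ ((StdForm.antidiagonal N).over K))
          (⟨zpowDiagGL (uniformizer_ne_zero hd.vϖ) ν.1, zpowDiagGL_mem_unitaryGroupOfForm hd.σϖ _ ν.2.2⟩ :
              unitaryGroupOfForm σ ((StdForm.antidiagonal N).over K)) := by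
  -- bottom data of the product, by induction on the list
  have hdata : ∀ L : List {a : Fin N → ℤ // Antitone a ∧ ∀ i, a (Fin.rev i) = -a i},
      (∀ μ, ((hd.isIwasawaExponent (N := N)).satakeTransform (1 : Multiplicative (Fin N → ℤ) →* R)
          (L.map fun a => heckeAlgebra.doubleCosetOperator (k := R) (unitaryInt σ ((StdForm.antidiagonal N).over K))
            (⟨zpowDiagGL (uniformizer_ne_zero hd.vϖ) a.1, zpowDiagGL_mem_unitaryGroupOfForm hd.σϖ _ a.2.2⟩ :
                unitaryGroupOfForm σ ((StdForm.antidiagonal N).over K))).prod).coeff μ ≠ 0 →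
        ∀ t : ℕ, (∑ i : Fin N, if (i : ℕ) < t then (fun j => -(L.map Subtype.val).sum j) i else 0) ≤
          ∑ i : Fin N, if (i : ℕ) < t then μ i else 0) ∧
      ((hd.isIwasawaExponent (N := N)).satakeTransform (1 : Multiplicative (Fin N → ℤ) →* R)
          (L.map fun a => heckeAlgebra.doubleCosetOperator (k := R) (unitaryInt σ ((StdForm.antidiagonal N).over K))
            (⟨zpowDiagGL (uniformizer_ne_zero hd.vϖ) a.1, zpowDiagGL_mem_unitaryGroupOfForm hd.σϖ _ a.2.2⟩ :
                unitaryGroupOfForm σ ((StdForm.antidiagonal N).over K))).prod).coeff (fun j => -(L.map Subtype.val).sum j) = 1 := by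
    intro L
    induction L with
    | nil =>
      have h0 : Antitone (0 : Fin N → ℤ) ∧ ∀ i, (0 : Fin N → ℤ) (Fin.rev i) = -(0 : Fin N → ℤ) i :=
        ⟨fun _ _ _ => le_rfl, fun i => by simp⟩
      have h := hd.coeff_satakeTransform_one_data_unitary (R := R) h0
      have h1 : heckeAlgebra.doubleCosetOperator (k := R) (unitaryInt σ ((StdForm.antidiagonal N).over K))
          (⟨zpowDiagGL (uniformizer_ne_zero hd.vϖ) (0 : Fin N → ℤ), zpowDiagGL_mem_unitaryGroupOfForm hd.σϖ _ h0.2⟩ :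
              unitaryGroupOfForm σ ((StdForm.antidiagonal N).over K)) = 1 := by
        rw [← heckeAlgebra.doubleCosetOperator_one (k := R) (unitaryInt σ ((StdForm.antidiagonal N).over K))]
        congr 1
        exact Subtype.ext (zpowDiagGL_zero _)
      rw [h1] at h
      rw [List.map_nil, List.prod_nil, List.map_nil, List.sum_nil]
      exact h
    | cons a L ih =>
      rw [List.map_cons, List.prod_cons, List.map_cons, List.sum_cons]
      exact hd.satakeTransform_one_mul_data_unitary (hd.coeff_satakeTransform_one_data_unitary (R := R) a.2) ih
  obtain ⟨htri, hlead⟩ := hdata L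
  exact hd.exists_finsupp_eq_sum_of_coeff_satakeTransform_one_unitary (antitone_list_sum L) htri hlead

end UnramifiedLocalConjDatum

end Literature.NumberTheory.Automorphic.HermitianLattice

end
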